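import Literature.Computability.FineGrained.SubcubicEquivalencesAPSP
import Literature.Computability.Cryptography.FGComplexityTrans
import HarnessLib

/-!
# Subcubic equivalence of APSP and Negative Triangle — the transitivity fact discharged

`Literature.Computability.FineGrained.SubcubicEquivalencesAPSP` decomposes VW–W J. ACM 65 (2018),
Thm. 1.1, (1) ⟺ (3), along the printed proof into four reduction facts and the transitivity of
sub-`q` reductions, `fgReducible_pow_trans_of_sizeFitsWord` (loc. cit., §3, Prop. 1, p. 27:10:
"Let `A, B, C` be problems so that `A ≤_q B` and `B ≤_q C`. Then `A ≤_q C`"; proof p. 27:11),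
transcribed for the word-RAM rendering `FGReducible` with the well-formedness hypotheses of the
prelude and `A.SizeFitsWord`. This file (a second proofs sibling of the statement file; the
sibling `…SubcubicEquivalencesAPSPProofs` discharges the Thm. 4.2 step
`minPlusProduct_fgReducible_negativeTriangle`) **discharges** that named fact
(`fgReducible_pow_trans_of_sizeFitsWord_holds`) from the theorem
`Cryptography.FGReducible.trans_rpow_of_sizeFitsWord` of
`Literature.Computability.Cryptography.FGComplexityTrans` — the verified composed reduction
`WordRAM.Inline.SIMF` (the outer reduction with every oracle call answered by an inline run of the
inner reduction whose own oracle calls are forwarded, `…WordRAMForward1–3`) together with its cost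
and ledger accounting — and records the in-file consequences with the transitivity hypothesis
removed: the two halves of Thm. 1.1 and the equivalence itself now follow from the paper's four
reduction steps alone.

## References

* V. Vassilevska Williams, R. R. Williams, *Subcubic equivalences between path, matrix, and triangle
  problems*, J. ACM 65 (2018), Art. 27: Thm. 1.1 (p. 27:3, proof p. 27:22), §3 Def. 3.1 and Prop. 1
  (p. 27:10, proof p. 27:11). doi:10.1145/3186893
-/

namespace Literature.Computability.FineGrained

open Cryptography Cryptography.WordRAM

/-- **VW–W 2018, §3, Prop. 1 (transitivity of sub-`q` reductions), discharged**: the named fact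
`fgReducible_pow_trans_of_sizeFitsWord` holds — it is the theorem
`Cryptography.FGReducible.trans_rpow_of_sizeFitsWord` (the composed word-RAM reduction with query
forwarding, `WordRAM.Inline.SIMF`, and its accounting).
[cite: VassilevskaWilliamsWilliams2018, §3 Prop. 1 (p. 27:10, proof p. 27:11)] -/
theorem fgReducible_pow_trans_of_sizeFitsWord_holds : fgReducible_pow_trans_of_sizeFitsWord :=
  fun hAB hBD hA hB hD hsz => FGReducible.trans_rpow_of_sizeFitsWord hAB hBD hA hB hD hsz

/-- **Negative Triangle `≤₃` APSP through the distance product**, now from the paper's two steps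
alone (Thm. 4.1, then the tripartite graph of the proof of Thm. 5.1): the transitivity hypothesis
of `negativeTriangle_fgReducible_APSP_of_minPlusProduct` is discharged.
[cite: VassilevskaWilliamsWilliams2018, Thm. 1.1 (proof p. 27:22)] -/
theorem negativeTriangle_fgReducible_APSP_of_minPlusProduct'
    (h₁ : negativeTriangle_fgReducible_minPlusProduct) (h₂ : minPlusProduct_fgReducible_APSP) :
    negativeTriangle_fgReducible_APSP :=
  negativeTriangle_fgReducible_APSP_of_minPlusProduct fgReducible_pow_trans_of_sizeFitsWord_holds h₁ h₂

/-- **APSP `≤₃` Negative Triangle through the distance product**, now from the paper's two steps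
alone (APSP `≤₃` distance product, §2 p. 27:8, then Thm. 4.2): the transitivity hypothesis of
`APSP_fgReducible_negativeTriangle_of_minPlusProduct` is discharged.
[cite: VassilevskaWilliamsWilliams2018, Thm. 1.1 (proof p. 27:22)] -/
theorem APSP_fgReducible_negativeTriangle_of_minPlusProduct'
    (h₁ : APSP_fgReducible_minPlusProduct) (h₂ : minPlusProduct_fgReducible_negativeTriangle) :
    APSP_fgReducible_negativeTriangle :=
  APSP_fgReducible_negativeTriangle_of_minPlusProduct fgReducible_pow_trans_of_sizeFitsWord_holds h₁ h₂

/-- **VW–W Thm. 1.1, (1) ⟺ (3), from the paper's four reduction steps alone** (transitivity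
discharged). [cite: VassilevskaWilliamsWilliams2018, Thm. 1.1 (proof p. 27:22)] -/
theorem subcubicEquivalent_APSP_negativeTriangle_of_minPlusProduct'
    (h₁ : APSP_fgReducible_minPlusProduct) (h₂ : minPlusProduct_fgReducible_negativeTriangle)
    (h₃ : negativeTriangle_fgReducible_minPlusProduct) (h₄ : minPlusProduct_fgReducible_APSP) :
    subcubicEquivalent_APSP_negativeTriangle :=
  subcubicEquivalent_APSP_negativeTriangle_of_minPlusProduct fgReducible_pow_trans_of_sizeFitsWord_holds
    h₁ h₂ h₃ h₄

end Literature.Computability.FineGrained
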